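/-
Copyright (c) 2026 the pub-hodgecm-mathlib formalisation cell (harness21).  Prover seat hodgecm-mathlib-K2E3-p21 (g2), HCML Track B «K2-LIT» (build stream 29),
h413 = `stmt-HodgeConjecture-24833`, line `K2_E3_EllipticInputs`, unit U3, line U3-d (lead K2E3-p03 (g0)), FILE C: THE INDEX BRIDGES (F1)(F2⁺)(F2⁻) of rungs C1∕C2
(line-lead RULINGS `K2/STATUS.md` 2026-09-03T23:04:51Z; file name = dealer K2E3-plan (g1) 23:09:48Z (b) «§0 residue-count glue»).  2026-09-03.
-/
import Literature.NumberTheory.Automorphic.SubgroupIndexDevissage                    -- ★ `relIndex_leAddSubgroup_exp` (`[{v ≤ exp a} : {v ≤ exp b}] = q^{(a-b)⁺}`), `map_mulLeft_leAddSubgroup`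
import Literature.NumberTheory.Automorphic.QuadraticPlaceDescentPins                  -- ★ `galAdicCompletionMap_eq_self_iff_mem_range` (fixed points of `σ_w` = `ι(F_v)`), `exists_units_galAdicCompletionMap_eq_neg` (skew unit); brings ★ `toPlace`, `valued_toPlace`
import Literature.NumberTheory.Automorphic.UnitaryGroupIntegralPointsReductionRamified -- ★ residue degrees at a non-split place: brings ★ Liu-D1 `card_residueField_eq_sq` (inert), `ramificationIdx'_eq_two_of_ne_one` ∕ `inertiaDeg_eq_one_of_ne_one` (ramified)
import Literature.RingTheory.DiscreteValuationRing.AdicCompletionResidueField         -- ★ `natCard_residueField_adicCompletion` (`|𝓀[K_v]| = |𝓞 ∕ v|`, `Valued` token), `finite_residueField_adicCompletion`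
import HarnessLib

/-!
# h413 ∕ Track B «K2-LIT», line U3-d, FILE C: THE LOCAL LATTICE SCALING INDICES `[𝒪_K : t𝒪_K] = Q`, `[𝒪⁺ : t𝒪⁺]² = Q`, `[𝒪⁻ : t²𝒪⁻] = Q` (`Q = q_K^{v_K(t)}`) AT A
# NON-SPLIT PLACE OF A QUADRATIC EXTENSION — the index bridges (F1)(F2⁺)(F2⁻) consumed by rungs C1 (transvection) and C2 (regular) of the unipotent scaling law

Cell `pub/hodgecm-mathlib`, crux H413 = `stmt-HodgeConjecture-24833`, route of record `HCCMUnconditional`; chair K2-lead (g0), dealer K2E3-plan (g1), line lead of U3-d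
K2E3-p03 (g0).  THEOREMS ONLY (no `def`, no `instance`, no `notation`, no named-fact hypothesis, no `sorry`); imports = ★ + HarnessLib; lane
`--supports stmt-HodgeConjecture-24833 --as helper` (count-neutral).  Companion of ★ p855528 `K2E3UnipotentAdaptedFrame` (same seat).

THE LETTERS (line lead 23:04:51Z ∕ 23:06:30Z, C2 = K2E1b-p01 (g3) 23:09:19Z, C1 = K2E4-p03 (g2) 23:03:56Z).  `K` a `ℤᵐ⁰`-valued field, `σ` an involution, `t ∈ K` with
`σ t = t`, `Valued.v t = exp(−k)`; the COMMON q-TOKEN `Q := (Nat.card 𝓀[K]) ^ k` (`= [𝒪_K : t𝒪_K]`, `𝓀[K]` the `Valued` residue field as in ★ `SubgroupIndexDevissage`); the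
lattices are AddSubgroups given by MEMBERSHIP LETTERS (no `def`): `hO : x ∈ O ↔ v x ≤ 1`, `hO⁺ : x ∈ O⁺ ↔ σ x = x ∧ v x ≤ 1`, `hO⁻ : x ∈ O⁻ ↔ σ x = −x ∧ v x ≤ 1`.
* (F1) `(O.map (mulLeft t)).relIndex O = Q` — §A, for ANY such `K` with a uniformiser letter `hϖ` and `[Finite 𝓀[K]]` (★ `map_mulLeft_leAddSubgroup` + ★ `relIndex_leAddSubgroup_exp`);
  at the place hypothesis-free (§B, `relIndex_map_mulLeft_eq_pow_place`).
* (F2⁺) `(O⁺.map (mulLeft t)).relIndex O⁺ ^ 2 = Q` and (F2⁻) `(O⁻.map (mulLeft (t*t))).relIndex O⁻ = Q` — §B, AT A NON-SPLIT PLACE `w ∣ v` of a quadratic extension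
  `E ∕ F` of number fields: `K := w.1.adicCompletion E`, `σ := σ_w = galAdicCompletionMap c hw` (`c ≠ 1`, `c • w = w`).  They are FALSE for an abstract isometric involution
  (`σ = id` gives `[O⁺ : tO⁺]² = Q²`): their content is the fundamental identity `e·f = 2`, which the tree holds at the place.  C1∕C2 keep `hF⁺ hF⁻` as hypotheses of their
  model-level heads; the assembly (K2E3-p03) discharges them with §B by `exact`.

THE MATHEMATICS ([Serre1979] Ch. I §1, Ch. II §3; [NeukirchANT1999] Ch. I §8 (8.2), Ch. II §4 (4.3); [CasselsFrohlichANT1967] Ch. VII §1.1).  `ι = ι_w : F_v → E_w` is injective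
with `v_w(ι y) = v_v(y)^e`, `e = e(w|v)` (★ `valued_toPlace`); the `σ_w`-fixed elements are exactly `ι(F_v)` (★ `galAdicCompletionMap_eq_self_iff_mem_range`), so `t = ι t₀` with
`e·k₀ = k`, `v_v(t₀) = exp(−k₀)`, and `O⁺ = ι(𝒪_v)`; a skew unit `λ` (`σ_w λ = −λ`, ★ `exists_units_galAdicCompletionMap_eq_neg`) gives `O⁻ = ι(B)·λ` for the BALL
`B = {y : v_v(y) ≤ exp(⌊−v_w-log(λ)∕e⌋)}` of `F_v` (`v_w(ι y·λ) ≤ 1 ⟺ v_v(y)^e ≤ v_w(λ)⁻¹`).  Indices transport along the injective additive maps `ι` and `y ↦ ι(y)·λ` (Mathlib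
`AddSubgroup.relIndex_map_map_of_injective`), so `[O⁺ : tO⁺] = [𝒪_v : t₀𝒪_v] = q_v^{k₀}` and `[O⁻ : t²O⁻] = [B : t₀²B] = q_v^{2k₀}` (★ `relIndex_leAddSubgroup_exp` in `F_v`, which has
a uniformiser).  Finally `e·f = 2` in the form **`q_w^e = q_v²`** (`natCard_residueField_pow_ramificationIdx_eq_sq`: inert `e = 1`, `q_w = q_v²` by ★ Liu-D1
`card_residueField_eq_sq`; ramified `e = 2`, `q_w = q_v` by ★ `inertiaDeg_eq_one_of_ne_one` + Mathlib `Ideal.absNorm_pow_inertiaDeg`) turns `q_v^{2k₀}` into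
`(q_w^e)^{k₀} = q_w^{k} = Q`.

HONEST LABEL.  HC_CM is proved only modulo the 7 printed citations (2 remaining named inputs: hLiu418 = `stmt-HodgeConjecture-24832`, h413 =
`stmt-HodgeConjecture-24833`) until rung 0 closes; this file is count-neutral local algebra (no letter of the print moves here).

## References
* [Serre1979] J.-P. Serre, *Local Fields*, GTM 67 (1979): Ch. I §1 Prop. 1 (ideals of a DVR), Ch. II §3 Prop. 5 (`#(𝒪∕𝔪^k) = q^k`), Ch. I §4 (e·f = n).
* [NeukirchANT1999] J. Neukirch, *Algebraic Number Theory*, Grundlehren 322 (1999): Ch. I §8 Prop. (8.2) (fundamental identity), Ch. II §4 Prop. (4.3) (completions: `e_w f_w = [E_w : F_v]`).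
* [CasselsFrohlichANT1967] J. W. S. Cassels, A. Fröhlich (eds.), *Algebraic Number Theory* (1967): Ch. VII §1.1 (the decomposition group acts on `E_w`; fixed field `F_v`).
* [HarishChandra1999AdmissibleDistributions] Harish-Chandra, *Admissible Invariant Distributions on Reductive p-adic Groups*, ULS 16 (1999), §3.1 Lemma 3.2 (where these indices are the modulus `|t|^{−dim}`).
-/

set_option autoImplicit false
set_option linter.dupNamespace false  -- the mandated namespace repeats the single-problem summit's segment (`HodgeConjecture.HodgeConjecture`)

noncomputable section

open NumberField IsDedekindDomain
open scoped Valued WithZero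
open Literature.NumberTheory.Automorphic Literature.NumberTheory.Automorphic.UnitaryGroup Literature.NumberTheory.AdelicBaseChange

namespace Summit.HodgeConjecture.HodgeConjecture.Cruxes.H413.K2E3LocalLatticeScalingIndex

/-! ## §0 `ℤᵐ⁰` bookkeeping -/

/-- `exp a ^ n = exp (n·a)` in `ℤᵐ⁰`. [cite: Serre1979, Ch. I §1] -/
theorem exp_pow (a : ℤ) (n : ℕ) : WithZero.exp a ^ n = WithZero.exp ((n : ℤ) * a) := by
  induction n with
  | zero => rw [pow_zero, Nat.cast_zero, zero_mul, WithZero.exp_zero]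
  | succ n ih => rw [pow_succ, ih, ← WithZero.exp_add, Nat.cast_succ]; ring_nf

/-- A non-zero element of `ℤᵐ⁰` is `exp` of its `log`. [cite: Serre1979, Ch. I §1] -/
theorem exp_log_of_ne_zero {γ : ℤᵐ⁰} (hγ : γ ≠ 0) : WithZero.exp (WithZero.log γ) = γ := WithZero.exp_log hγ

/-- `(exp m)^e ≤ exp n ↔ m ≤ n ∕ e` (floor division) for `0 < e`. [cite: Serre1979, Ch. I §1] -/
theorem exp_pow_le_exp_iff {e : ℕ} (he : 0 < e) (m n : ℤ) : WithZero.exp m ^ e ≤ WithZero.exp n ↔ m ≤ n / e := by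
  rw [exp_pow, WithZero.exp_le_exp, Int.le_ediv_iff_mul_le (by exact_mod_cast he), mul_comm]

/-! ## §A (F1) `[𝒪 : t𝒪] = q^k` for any `ℤᵐ⁰`-valued field with a uniformiser and finite residue field -/

section Abstract

variable {K : Type*} [Field K] [Valued K ℤᵐ⁰] {ϖ : K}

/-- A valuation `exp(−k)` is non-zero, so `t ≠ 0`. [cite: Serre1979, Ch. I §1] -/
theorem ne_zero_of_valued_eq_exp {t : K} {a : ℤ} (ht : Valued.v t = WithZero.exp a) : t ≠ 0 := by
  intro h
  rw [h, map_zero] at ht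
  exact WithZero.coe_ne_zero ht.symm

/-- **`[{v ≤ exp b} : t·{v ≤ exp b}] = q^k`** for `v t = exp(−k)`: `t·{v ≤ exp b} = {v ≤ exp(b − k)}` (★ `map_mulLeft_leAddSubgroup`) and ★ `relIndex_leAddSubgroup_exp`.
[cite: Serre1979, Ch. II §3 Prop. 5] -/
theorem relIndex_map_mulLeft_leAddSubgroup_eq_pow (hϖ : Valued.v ϖ = WithZero.exp (-1 : ℤ)) [Finite 𝓀[K]] {t : K} {k : ℕ}
    (ht : Valued.v t = WithZero.exp (-(k : ℤ))) (b : ℤ) :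
    (((Valued.v : Valuation K ℤᵐ⁰).leAddSubgroup (WithZero.exp b)).map (AddMonoidHom.mulLeft t)).relIndex
        ((Valued.v : Valuation K ℤᵐ⁰).leAddSubgroup (WithZero.exp b)) = Nat.card 𝓀[K] ^ k := by
  rw [map_mulLeft_leAddSubgroup (ne_zero_of_valued_eq_exp ht), ht, ← WithZero.exp_add, relIndex_leAddSubgroup_exp hϖ]
  congr 1
  omega

/-- **(F1) `[𝒪 : t𝒪] = Q = q^k`** in the membership-letter currency: `hO : x ∈ O ↔ v x ≤ 1`, `v t = exp(−k)` ⟹ `(O.map (mulLeft t)).relIndex O = (Nat.card 𝓀[K])^k`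
(any `ℤᵐ⁰`-valued field with a uniformiser `ϖ` and finite residue field). [cite: Serre1979, Ch. II §3 Prop. 5] -/
theorem relIndex_map_mulLeft_eq_pow (hϖ : Valued.v ϖ = WithZero.exp (-1 : ℤ)) [Finite 𝓀[K]] {t : K} {k : ℕ} (ht : Valued.v t = WithZero.exp (-(k : ℤ)))
    {O : AddSubgroup K} (hO : ∀ x, x ∈ O ↔ Valued.v x ≤ 1) :
    (O.map (AddMonoidHom.mulLeft t)).relIndex O = Nat.card 𝓀[K] ^ k := by
  have hO' : O = (Valued.v : Valuation K ℤᵐ⁰).leAddSubgroup (WithZero.exp 0) := by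
    ext x; rw [hO, Valuation.mem_leAddSubgroup_iff, WithZero.exp_zero]
  rw [hO']
  exact relIndex_map_mulLeft_leAddSubgroup_eq_pow hϖ ht 0

end Abstract

/-! ## §B (F1)(F2⁺)(F2⁻) at a non-split place `w ∣ v` of a quadratic extension `E ∕ F`: `K = E_w`, `σ = σ_w` -/

section Place

variable {F E : Type} [Field F] [NumberField F] [Field E] [NumberField E] [Algebra F E] [Algebra.IsQuadraticExtension F E]
  (c : E ≃ₐ[F] E) (hc : c ≠ 1) (v : HeightOneSpectrum (𝓞 F)) (w : PlacesOver E v) (hw : c • w.1 = w.1)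

/-! ### §B.0 The structure map `ι : F_v → E_w`: valuation, balls, fixed scalars -/

omit [NumberField F] [Algebra.IsQuadraticExtension F E] in
/-- `e(w|v) > 0`. [cite: NeukirchANT1999, Ch. I §8 Prop. (8.2)] -/
theorem ramificationIdx'_pos : 0 < v.asIdeal.ramificationIdx' w.1.asIdeal := by
  haveI := PlacesOver.liesOver (E := E) w
  exact Nat.pos_of_ne_zero (Ideal.IsDedekindDomain.ramificationIdx'_ne_zero_of_liesOver w.1.asIdeal v.ne_bot)

omit [Algebra.IsQuadraticExtension F E] in
/-- `v_w(ι y) = v_v(y)^{e(w|v)}` for `ι = algebraMap F_v E_w` (★ `valued_toPlace`). [cite: NeukirchANT1999, Ch. II §4 Prop. (4.3)] -/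
theorem valued_algebraMap_eq_pow (y : v.adicCompletion F) :
    Valued.v (algebraMap (v.adicCompletion F) (w.1.adicCompletion E) y) = Valued.v y ^ v.asIdeal.ramificationIdx' w.1.asIdeal := by
  rw [← toPlace_eq_algebraMap_adicCompletion]; exact valued_toPlace v w y

omit [Algebra.IsQuadraticExtension F E] in
/-- **Balls pull back to balls**: `v_w(ι y) ≤ exp n ⟺ v_v(y) ≤ exp ⌊n∕e⌋`. [cite: Serre1979, Ch. I §1] -/
theorem valued_algebraMap_le_exp_iff (y : v.adicCompletion F) (n : ℤ) :
    Valued.v (algebraMap (v.adicCompletion F) (w.1.adicCompletion E) y) ≤ WithZero.exp n ↔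
      Valued.v y ≤ WithZero.exp (n / (v.asIdeal.ramificationIdx' w.1.asIdeal : ℕ)) := by
  rw [valued_algebraMap_eq_pow]
  by_cases hy : y = 0
  · simp [hy, zero_pow (ramificationIdx'_pos v w).ne']
  · have hvy : Valued.v y ≠ 0 := (Valuation.ne_zero_iff _).2 hy
    rw [← exp_log_of_ne_zero hvy, exp_pow_le_exp_iff (ramificationIdx'_pos v w), WithZero.exp_le_exp]

include hc in
/-- **A `σ_w`-fixed scalar of valuation `exp(−k)` is `ι t₀` with `v_v(t₀) = exp(−k₀)`, `e·k₀ = k`** (★ fixed points = `ι(F_v)`, ★ `v_w ∘ ι = v_v^e`).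
[cite: CasselsFrohlichANT1967, Ch. VII §1.1] [cite: NeukirchANT1999, Ch. II §4 Prop. (4.3)] -/
theorem exists_eq_algebraMap_of_fixed {t : w.1.adicCompletion E} (hσt : galAdicCompletionMap (L := E) c hw t = t) {k : ℕ}
    (ht : Valued.v t = WithZero.exp (-(k : ℤ))) :
    ∃ (t₀ : v.adicCompletion F) (k₀ : ℕ), algebraMap (v.adicCompletion F) (w.1.adicCompletion E) t₀ = t ∧
      Valued.v t₀ = WithZero.exp (-(k₀ : ℤ)) ∧ v.asIdeal.ramificationIdx' w.1.asIdeal * k₀ = k := by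
  obtain ⟨t₀, rfl⟩ := (galAdicCompletionMap_eq_self_iff_mem_range c hc v w hw t).1 hσt
  have ht0 : t₀ ≠ 0 := by
    intro h; rw [h, map_zero, map_zero] at ht; exact WithZero.coe_ne_zero ht.symm
  have hvt : Valued.v t₀ ≠ 0 := (Valuation.ne_zero_iff _).2 ht0
  set m := WithZero.log (Valued.v t₀) with hm
  have hm' : Valued.v t₀ = WithZero.exp m := (exp_log_of_ne_zero hvt).symm
  rw [valued_algebraMap_eq_pow, hm', exp_pow] at ht
  have hem : ((v.asIdeal.ramificationIdx' w.1.asIdeal : ℕ) : ℤ) * m = -(k : ℤ) := WithZero.exp_injective ht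
  have he := ramificationIdx'_pos v w
  have hm0 : m ≤ 0 := by
    by_contra hpos
    have hpos' : 0 < m := lt_of_not_ge hpos
    have : (0 : ℤ) < ((v.asIdeal.ramificationIdx' w.1.asIdeal : ℕ) : ℤ) * m := mul_pos (by exact_mod_cast he) hpos'
    omega
  refine ⟨t₀, (-m).toNat, rfl, ?_, ?_⟩
  · rw [hm', Int.toNat_of_nonneg (by omega), neg_neg]
  · have h1 : ((v.asIdeal.ramificationIdx' w.1.asIdeal * (-m).toNat : ℕ) : ℤ) = (k : ℤ) := by
      rw [Nat.cast_mul, Int.toNat_of_nonneg (by omega)]; linear_combination -hem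
    exact_mod_cast h1

/-! ### §B.1 `e·f = 2` in the form `q_w^e = q_v²` -/

include hc hw in
/-- At a non-split `w ∣ v` that is NOT unramified, `e(w|v) ≠ 1` (`w` is the only prime above `v`, ★ `PlacesOver.eq_of_smul_eq`; Mathlib `Ideal.ramificationIdx_eq_one_iff`).
[cite: NeukirchANT1999, Ch. I §8 Prop. (8.2)] -/
theorem ramificationIdx'_ne_one_of_not_isUnramifiedIn (hram : ¬ Algebra.IsUnramifiedIn (𝓞 E) v.asIdeal) :
    v.asIdeal.ramificationIdx' w.1.asIdeal ≠ 1 := by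
  intro he
  apply hram
  intro P hP hPover
  have hP0 : P ≠ ⊥ := Ideal.ne_bot_of_liesOver_of_ne_bot v.ne_bot P
  have hPw : P = w.1.asIdeal :=
    congrArg (fun u : PlacesOver E v => u.1.asIdeal)
      (PlacesOver.eq_of_smul_eq c hc w hw ⟨⟨P, hP, hP0⟩, HeightOneSpectrum.ext hPover.over.symm⟩)
  subst hPw
  haveI : v.asIdeal.IsMaximal := v.isMaximal
  rw [← Ideal.ramificationIdx_eq_one_iff, ← Ideal.ramificationIdx'_eq_ramificationIdx v.asIdeal w.1.asIdeal v.ne_bot]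
  exact he

include hc hw in
/-- **`e·f = 2` AS `q_w^{e(w|v)} = q_v²`** at a non-split place (`q_w = #𝓀[E_w]`, `q_v = #𝓀[F_v]`, `Valued` residue fields = `𝓞∕𝔭` by ★ `natCard_residueField_adicCompletion`):
inert `e = 1`, `q_w = q_v²` (★ Liu-D1 `card_residueField_eq_sq`); ramified `e = 2` (★ `ramificationIdx'_eq_two_of_ne_one`), `q_w = q_v` (`f = 1`, ★ `inertiaDeg_eq_one_of_ne_one`,
Mathlib `Ideal.absNorm_pow_inertiaDeg`). [cite: NeukirchANT1999, Ch. I §8 Prop. (8.2); Ch. II §4 Prop. (4.3)] -/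
theorem natCard_residueField_pow_ramificationIdx_eq_sq :
    Nat.card 𝓀[w.1.adicCompletion E] ^ v.asIdeal.ramificationIdx' w.1.asIdeal = Nat.card 𝓀[v.adicCompletion F] ^ 2 := by
  rw [HeightOneSpectrum.natCard_residueField_adicCompletion E w.1, HeightOneSpectrum.natCard_residueField_adicCompletion F v]
  haveI := PlacesOver.liesOver (E := E) w
  by_cases hv : Algebra.IsUnramifiedIn (𝓞 E) v.asIdeal
  · rw [Ideal.ramificationIdx'_eq_ramificationIdx v.asIdeal w.1.asIdeal v.ne_bot, hv.ramificationIdx_eq_one (PlacesOver.liesOver w), pow_one]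
    exact Liu2021.LemD1IndexedNonVacuityInertFrobenius.card_residueField_eq_sq E c v hc hv w hw
  · have he := ramificationIdx'_ne_one_of_not_isUnramifiedIn c hc v w hw hv
    rw [Liu2021.LemD1IndexedNonVacuityRamifiedPlace.ramificationIdx'_eq_two_of_ne_one E v c hc w hw he]
    have h := Ideal.absNorm_pow_inertiaDeg v.asIdeal w.1.asIdeal
    rw [Liu2021.LemD1IndexedNonVacuityRamifiedPlace.inertiaDeg_eq_one_of_ne_one E v c hc w hw he, pow_one,
      Ideal.absNorm_apply, Ideal.absNorm_apply, Submodule.cardQuot_apply, Submodule.cardQuot_apply] at h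
    rw [h]

/-! ### §B.2 (F1) at the place -/

omit [NumberField F] [Algebra.IsQuadraticExtension F E] in
/-- **(F1) AT THE PLACE, hypothesis-free**: `E_w` has a uniformiser (Mathlib `valuation_exists_uniformizer`) and a finite residue field, so for `v t = exp(−k)` and `hO : x ∈ O ↔ v x ≤ 1`:
`(O.map (mulLeft t)).relIndex O = (Nat.card 𝓀[E_w])^k`. [cite: Serre1979, Ch. II §3 Prop. 5] -/
theorem relIndex_map_mulLeft_eq_pow_place {t : w.1.adicCompletion E} {k : ℕ} (ht : Valued.v t = WithZero.exp (-(k : ℤ)))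
    {O : AddSubgroup (w.1.adicCompletion E)} (hO : ∀ x, x ∈ O ↔ Valued.v x ≤ 1) :
    (O.map (AddMonoidHom.mulLeft t)).relIndex O = Nat.card 𝓀[w.1.adicCompletion E] ^ k := by
  obtain ⟨π, hπ⟩ := HeightOneSpectrum.valuation_exists_uniformizer E w.1
  have hϖ : Valued.v ((π : E) : w.1.adicCompletion E) = WithZero.exp (-1 : ℤ) := by
    rw [HeightOneSpectrum.valuedAdicCompletion_eq_valuation', hπ]
  haveI : Finite (𝓞 E ⧸ w.1.asIdeal) := w.1.asIdeal.finiteQuotientOfFreeOfNeBot w.1.ne_bot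
  haveI : Finite 𝓀[w.1.adicCompletion E] := HeightOneSpectrum.finite_residueField_adicCompletion E w.1
  exact relIndex_map_mulLeft_eq_pow hϖ ht hO

/-! ### §B.3 (F2⁺): `[O⁺ : tO⁺]² = Q` -/

include hc in
/-- **(F2⁺) `[𝒪⁺ : t𝒪⁺]² = Q`**: for `σ = σ_w`, `σ t = t`, `v t = exp(−k)` and `hO⁺ : x ∈ O⁺ ↔ σ x = x ∧ v x ≤ 1`:
`(O⁺.map (mulLeft t)).relIndex O⁺ ^ 2 = (Nat.card 𝓀[E_w])^k`.  (`O⁺ = ι(𝒪_v)`, `t = ι t₀`, `[O⁺ : tO⁺] = [𝒪_v : t₀𝒪_v] = q_v^{k₀}`, `q_v^{2k₀} = (q_w^e)^{k₀} = q_w^k`.)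
[cite: NeukirchANT1999, Ch. I §8 Prop. (8.2)] [cite: Serre1979, Ch. II §3 Prop. 5] [cite: CasselsFrohlichANT1967, Ch. VII §1.1] -/
theorem relIndex_map_mulLeft_fixedBall_sq_eq_pow {t : w.1.adicCompletion E} (hσt : galAdicCompletionMap (L := E) c hw t = t) {k : ℕ}
    (ht : Valued.v t = WithZero.exp (-(k : ℤ))) {Op : AddSubgroup (w.1.adicCompletion E)}
    (hOp : ∀ x, x ∈ Op ↔ galAdicCompletionMap (L := E) c hw x = x ∧ Valued.v x ≤ 1) :
    (Op.map (AddMonoidHom.mulLeft t)).relIndex Op ^ 2 = Nat.card 𝓀[w.1.adicCompletion E] ^ k := by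
  obtain ⟨t₀, k₀, ht₀, hvt₀, hek⟩ := exists_eq_algebraMap_of_fixed c hc v w hw hσt ht
  -- `O⁺ = ι(𝒪_v)` for the ball `{v_v ≤ exp 0}`
  have hOp' : Op = ((Valued.v : Valuation (v.adicCompletion F) ℤᵐ⁰).leAddSubgroup (WithZero.exp 0)).map
      (algebraMap (v.adicCompletion F) (w.1.adicCompletion E)).toAddMonoidHom := by
    ext x
    rw [hOp, AddSubgroup.mem_map]
    constructor
    · rintro ⟨hfix, hle⟩
      obtain ⟨a, rfl⟩ := (galAdicCompletionMap_eq_self_iff_mem_range c hc v w hw x).1 hfix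
      refine ⟨a, ?_, rfl⟩
      rw [Valuation.mem_leAddSubgroup_iff, WithZero.exp_zero, ← valued_toPlace_le_one_iff w a, toPlace_eq_algebraMap_adicCompletion]
      exact hle
    · rintro ⟨a, ha, rfl⟩
      rw [Valuation.mem_leAddSubgroup_iff, WithZero.exp_zero] at ha
      refine ⟨(galAdicCompletionMap_eq_self_iff_mem_range c hc v w hw _).2 ⟨a, rfl⟩, ?_⟩
      rw [RingHom.toAddMonoidHom_eq_coe, AddMonoidHom.coe_coe, ← toPlace_eq_algebraMap_adicCompletion, valued_toPlace_le_one_iff w a]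
      exact ha
  -- `t·O⁺ = ι(t₀·𝒪_v)`
  have hcomm : (AddMonoidHom.mulLeft t).comp (algebraMap (v.adicCompletion F) (w.1.adicCompletion E)).toAddMonoidHom =
      (algebraMap (v.adicCompletion F) (w.1.adicCompletion E)).toAddMonoidHom.comp (AddMonoidHom.mulLeft t₀) :=
    AddMonoidHom.ext fun a => by
      simp only [AddMonoidHom.coe_comp, Function.comp_apply, AddMonoidHom.coe_mulLeft, RingHom.toAddMonoidHom_eq_coe, AddMonoidHom.coe_coe, map_mul, ht₀]
  have hinj : Function.Injective (algebraMap (v.adicCompletion F) (w.1.adicCompletion E)).toAddMonoidHom :=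
    (algebraMap (v.adicCompletion F) (w.1.adicCompletion E)).injective
  rw [hOp', AddSubgroup.map_map, hcomm, ← AddSubgroup.map_map, AddSubgroup.relIndex_map_map_of_injective _ _ hinj]
  -- count in `F_v`
  obtain ⟨π, hπ⟩ := HeightOneSpectrum.valuation_exists_uniformizer F v
  have hϖ : Valued.v ((π : F) : v.adicCompletion F) = WithZero.exp (-1 : ℤ) := by
    rw [HeightOneSpectrum.valuedAdicCompletion_eq_valuation', hπ]
  haveI : Finite (𝓞 F ⧸ v.asIdeal) := v.asIdeal.finiteQuotientOfFreeOfNeBot v.ne_bot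
  haveI : Finite 𝓀[v.adicCompletion F] := HeightOneSpectrum.finite_residueField_adicCompletion F v
  rw [relIndex_map_mulLeft_leAddSubgroup_eq_pow hϖ hvt₀ 0, ← pow_mul, mul_comm, pow_mul,
    ← natCard_residueField_pow_ramificationIdx_eq_sq c hc v w hw, ← pow_mul, hek]

/-! ### §B.4 (F2⁻): `[O⁻ : t²O⁻] = Q` -/

include hc in
/-- **(F2⁻) `[𝒪⁻ : t²𝒪⁻] = Q`**: for `σ = σ_w`, `σ t = t`, `v t = exp(−k)` and `hO⁻ : x ∈ O⁻ ↔ σ x = −x ∧ v x ≤ 1`: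
`(O⁻.map (mulLeft (t * t))).relIndex O⁻ = (Nat.card 𝓀[E_w])^k`.  (`O⁻ = ι(B)·λ` for a skew unit `λ` and the ball `B = {v_v ≤ exp ⌊−log v_w(λ)∕e⌋}` of `F_v`;
`[O⁻ : t²O⁻] = [B : t₀²B] = q_v^{2k₀} = q_w^k`.) [cite: NeukirchANT1999, Ch. I §8 Prop. (8.2)] [cite: Serre1979, Ch. II §3 Prop. 5] [cite: CasselsFrohlichANT1967, Ch. VII §1.1] -/
theorem relIndex_map_mulLeft_skewBall_eq_pow {t : w.1.adicCompletion E} (hσt : galAdicCompletionMap (L := E) c hw t = t) {k : ℕ}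
    (ht : Valued.v t = WithZero.exp (-(k : ℤ))) {Om : AddSubgroup (w.1.adicCompletion E)}
    (hOm : ∀ x, x ∈ Om ↔ galAdicCompletionMap (L := E) c hw x = -x ∧ Valued.v x ≤ 1) :
    (Om.map (AddMonoidHom.mulLeft (t * t))).relIndex Om = Nat.card 𝓀[w.1.adicCompletion E] ^ k := by
  obtain ⟨t₀, k₀, ht₀, hvt₀, hek⟩ := exists_eq_algebraMap_of_fixed c hc v w hw hσt ht
  obtain ⟨lam, hlam⟩ := exists_units_galAdicCompletionMap_eq_neg c hc v w hw
  have hlam0 : (lam : w.1.adicCompletion E) ≠ 0 := lam.ne_zero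
  have hvlam : Valued.v (lam : w.1.adicCompletion E) ≠ 0 := (Valuation.ne_zero_iff _).2 hlam0
  have hl' : Valued.v (lam : w.1.adicCompletion E) = WithZero.exp (WithZero.log (Valued.v (lam : w.1.adicCompletion E))) :=
    (exp_log_of_ne_zero hvlam).symm
  have hσι : ∀ a, galAdicCompletionMap (L := E) c hw (algebraMap (v.adicCompletion F) (w.1.adicCompletion E) a) =
      algebraMap (v.adicCompletion F) (w.1.adicCompletion E) a :=
    fun a => (galAdicCompletionMap_eq_self_iff_mem_range c hc v w hw _).2 ⟨a, rfl⟩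
  -- the additive embedding `φ : a ↦ ι(a)·λ`
  have hφa : ∀ a, ((AddMonoidHom.mulRight (lam : w.1.adicCompletion E)).comp (algebraMap (v.adicCompletion F) (w.1.adicCompletion E)).toAddMonoidHom) a =
      algebraMap (v.adicCompletion F) (w.1.adicCompletion E) a * lam := fun a => rfl
  have hinj : Function.Injective ((AddMonoidHom.mulRight (lam : w.1.adicCompletion E)).comp (algebraMap (v.adicCompletion F) (w.1.adicCompletion E)).toAddMonoidHom) :=
    fun a b hab => by
      rw [hφa, hφa] at hab
      exact (algebraMap (v.adicCompletion F) (w.1.adicCompletion E)).injective (mul_right_cancel₀ hlam0 hab)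
  -- `O⁻ = φ(B)` for the ball `B = {v ≤ exp ⌊−l∕e⌋}`, `l = log v(λ)`
  have hball : ∀ a : v.adicCompletion F, Valued.v (algebraMap (v.adicCompletion F) (w.1.adicCompletion E) a * lam) ≤ 1 ↔
      a ∈ (Valued.v : Valuation (v.adicCompletion F) ℤᵐ⁰).leAddSubgroup
        (WithZero.exp ((-WithZero.log (Valued.v (lam : w.1.adicCompletion E))) / (v.asIdeal.ramificationIdx' w.1.asIdeal : ℕ))) := fun a => by
    rw [Valuation.mem_leAddSubgroup_iff, ← valued_algebraMap_le_exp_iff v w a, map_mul, WithZero.exp_neg, ← hl',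
      ← le_mul_inv_iff₀ (zero_lt_iff.2 hvlam), one_mul]
  have hOm' : Om = ((Valued.v : Valuation (v.adicCompletion F) ℤᵐ⁰).leAddSubgroup
      (WithZero.exp ((-WithZero.log (Valued.v (lam : w.1.adicCompletion E))) / (v.asIdeal.ramificationIdx' w.1.asIdeal : ℕ)))).map
      ((AddMonoidHom.mulRight (lam : w.1.adicCompletion E)).comp (algebraMap (v.adicCompletion F) (w.1.adicCompletion E)).toAddMonoidHom) := by
    ext x
    rw [hOm, AddSubgroup.mem_map]
    constructor
    · rintro ⟨hskew, hle⟩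
      have hfix : galAdicCompletionMap (L := E) c hw (x * (lam : w.1.adicCompletion E)⁻¹) = x * (lam : w.1.adicCompletion E)⁻¹ := by
        rw [map_mul, map_inv₀, hskew, hlam, inv_neg, neg_mul_neg]
      obtain ⟨a, ha⟩ := (galAdicCompletionMap_eq_self_iff_mem_range c hc v w hw _).1 hfix
      have hx : x = algebraMap (v.adicCompletion F) (w.1.adicCompletion E) a * lam := by rw [ha, inv_mul_cancel_right₀ hlam0]
      exact ⟨a, (hball a).1 (hx ▸ hle), by rw [hφa, hx]⟩
    · rintro ⟨a, ha, rfl⟩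
      refine ⟨?_, (hball a).2 ha⟩
      rw [hφa, map_mul, hσι, hlam, mul_neg]
  -- `t²·O⁻ = φ(t₀²·B)`
  have hcomm : (AddMonoidHom.mulLeft (t * t)).comp
        ((AddMonoidHom.mulRight (lam : w.1.adicCompletion E)).comp (algebraMap (v.adicCompletion F) (w.1.adicCompletion E)).toAddMonoidHom) =
      ((AddMonoidHom.mulRight (lam : w.1.adicCompletion E)).comp (algebraMap (v.adicCompletion F) (w.1.adicCompletion E)).toAddMonoidHom).comp
        (AddMonoidHom.mulLeft (t₀ * t₀)) :=
    AddMonoidHom.ext fun a => by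
      simp only [AddMonoidHom.coe_comp, Function.comp_apply, AddMonoidHom.coe_mulLeft, AddMonoidHom.coe_mulRight, RingHom.toAddMonoidHom_eq_coe,
        AddMonoidHom.coe_coe, map_mul, ht₀]
      ring
  rw [hOm', AddSubgroup.map_map, hcomm, ← AddSubgroup.map_map, AddSubgroup.relIndex_map_map_of_injective _ _ hinj]
  -- count in `F_v`: `v (t₀²) = exp (−2k₀)`
  obtain ⟨π, hπ⟩ := HeightOneSpectrum.valuation_exists_uniformizer F v
  have hϖ : Valued.v ((π : F) : v.adicCompletion F) = WithZero.exp (-1 : ℤ) := by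
    rw [HeightOneSpectrum.valuedAdicCompletion_eq_valuation', hπ]
  haveI : Finite (𝓞 F ⧸ v.asIdeal) := v.asIdeal.finiteQuotientOfFreeOfNeBot v.ne_bot
  haveI : Finite 𝓀[v.adicCompletion F] := HeightOneSpectrum.finite_residueField_adicCompletion F v
  have hvt₀2 : Valued.v (t₀ * t₀) = WithZero.exp (-((2 * k₀ : ℕ) : ℤ)) := by
    rw [map_mul, hvt₀, ← WithZero.exp_add]; congr 1; push_cast; ring
  rw [relIndex_map_mulLeft_leAddSubgroup_eq_pow hϖ hvt₀2, pow_mul, ← natCard_residueField_pow_ramificationIdx_eq_sq c hc v w hw, ← pow_mul, hek]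

end Place

end Summit.HodgeConjecture.HodgeConjecture.Cruxes.H413.K2E3LocalLatticeScalingIndex

end
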